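import Mathlib
import Summits.HodgeConjecture.FermatCycles.HodgeFermatFiveThreeFinal

/-!
# PROPOSITION D′(3N) and THE DESCENT at every squarefree level 3N — THEOREM F* in full, modulo KR6′/ThmUPlus′/F*(3N) as named hypotheses — part 1 (`HodgeFermat/PropDPrimeN.lean`; HF-G34)

Tree copy (part 1 of 2) of the module `HodgeFermat/PropDPrimeN.lean` of the sibling cell's standalone package
`run/shared/lean/pub/pub-hodgefermat/lean/HodgeFermat/` (398 lines, sha256 `adb67a1bc7bcf667…`), source lines 41–296 (§§0–2: the named hypothesis `Fstar`, level facts, PROPOSITION D′(3N) `propDprime` from KR6′/ThmUPlus′/F*, the reduction `reduce`, `units39`, `Share`, THE DESCENT `descent`, `noCoincidence`).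
Filed by cell `pub-hfermat`, seat prover-1 gen-3, on the COORDINATOR KEEPER RULING of 2026-08-25 (gem sweep H1: take the
off-gate kernel theorem `thmFstar` through the gate) — here THEOREM F* of `tables/DPRIME-THEOREM.md` §9 IN FULL, i.e.
PROPOSITION D′(3N) and the descent (`HodgeFermat/PropDPrimeNFinal.lean`, GATE HF-G34), the last off-gate form of THEOREM F*
(its first two forms, `DecodingFinal.thmFstar` = F* at the prime levels and `ThmFstarNFinal.thmFstar` = F*(3N), landed on
2026-08-25 as `HodgeFermatThmFstar.lean` / `HodgeFermatThmFstarN.lean`, seats prover-1 gen-0 / gen-2); this file is one link of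
the import closure of `PropDPrimeNFinal.propDprime` (the sibling's KR-free chain: THEOREM L, COROLLARY M, THEOREM D6,
THEOREM U⁺, THEOREM KR6, THEOREM Z3U) on top of those landed chains.  The source module is the sibling's hub-checked module of
record (pub-hodgefermat `CERT.md` l.990, GATE HF-G34; cell records `check/PropDPrimeN_link_standalone.lean` sha256 `83292861a9d8777a…` / `check/DecodingDPrime_part1_standalone.lean`); its declarations are copied VERBATIM.
Deviations from the source module, exhaustively: the `import` lines (tree modules `Summits.HodgeConjecture.FermatCycles.
HodgeFermat*` instead of `HodgeFermat.*`); this module docstring; one-line docstrings added (gate lint) to `instDecidableShare`, `share_common`; the file ends at source l.296 with an `end` line (part 2 = `HodgeFermatPropDPrimeNB.lean`).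
Every other line — in particular every declaration's statement and proof — is byte-identical to the source.
HONEST FRAMING: explicit algebraic cycles for specific Hodge classes on Fermat/Delsarte varieties; residual open instances
listed; no claim on general Hodge.  (This file is arithmetic of CM types / finite combinatorics / analytic number theory
of the sibling's KR-free programme; it claims nothing about cycles.)

The source module's docstring (PropDPrimeN.lean l.6–39), verbatim:

## PROPOSITION D′(3N) and THE DESCENT at every squarefree level 3N — THEOREM F* in full (HF-G34)

`tables/DPRIME-THEOREM.md` §9.  Gen 32 proved PROPOSITION D′ at the prime levels `3p` (`DecodingDPrime.propDprime_prime`: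
COROLLARY M + THEOREM F*(3p)); gen 33 proved THEOREM F\*(3N) — no disjoint coincidence of CM types with entries prime to `N` —
at EVERY squarefree `N ≥ 11`, `N ≠ 13` with all primes `≥ 11` (`ThmFstarN.thmFstarN`, unconditional in `ThmFstarNFinal.thmFstar`).
This light module (COROLLARY M side of the import graph; it imports `ThreeFinal` only and takes THEOREM F\*(3N) as the
hypothesis `Fstar`, whose text is `ThmFstarNFinal.thmFstar` curried — the union of the two import cones exceeds the hub's
one-file cap, exactly as in generation 32) closes the composite levels:

* `propDprime` — **PROPOSITION D′(3N)**: for every squarefree `N` with all prime factors `≥ 11` and `N ≠ 13` (so `N = 1` or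
  `N ≥ 11`), two DISJOINT, JOINTLY PRIMITIVE zero-sum triples mod `3N` with no entry `≡ 0 (mod 3N)` never have the same CM type.
  Proof: COROLLARY M (`ThreeFinal.corollaryM_final`, under `KR6'` and `ThmUPlus'`) at the squarefree odd level `m = 3N`: every
  prime `q ≥ 7` of `m` divides no entry, so all six entries are prime to `N`; `N = 1` is clause 4 of COROLLARY M (`3 ∉ {21, 39}`),
  `N ≥ 11` is THEOREM F\*(3N).
* `descent` — **THE DESCENT** (THEOREM F\* in full, no primitivity and no coprimality assumed): two disjoint zero-sum triples
  mod `3N` (same `N`, now `N = 13·g` allowed) with no entry `≡ 0 (mod 3N)` and the same CM type are `g = N/13` times one of the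
  twelve disjoint all-unit pairs of level `39` (the two 4-element classes `units39` of the complete level-39 list `CoincFull.classes39`,
  THEOREM D′); in particular (`noCoincidence`) there is NO such pair when `13 ∤ N`.  Proof: `g :=` the gcd of `3N` and the six entries; dividing by `g` (`Descent.sameType_descend`) gives a jointly
  primitive disjoint coincidence at the squarefree odd level `ℓ = 3N/g`; COROLLARY M at `ℓ` gives `3 ∣ ℓ`, `ℓ = 3ℓ₁`, `ℓ₁ ∣ N`, all
  reduced entries prime to `ℓ₁`; `ℓ₁ = 1` is clause 4 again, `ℓ₁ = 13` is the complete level-39 list `CoincFull.fullAt_39`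
  (its `Perm3` alternative contradicts disjointness, and so does every class other than the two of `units39`: in each of the other
  36 classes any two members share an entry — `classes39_share`, `decide`), and every other `ℓ₁` is excluded by THEOREM F\*(3ℓ₁).
* `sameType_lift`, `units39_lift` — THE CONVERSE: multiplying the level and both triples by `g > 0` preserves the CM type, and
  for every `g > 0` and every pair `T ≠ T′` in one class of `units39` the multiples `g·T`, `g·T′` ARE a disjoint coincidence at level
  `3·(13·g)` (zero sums, no entry `≡ 0`, disjoint, same type — `CoincFull.classes39_sameType` + the kernel facts `units39_facts`,
  `units39_disjoint`); so the description by `descent` is exact.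

Lake-only composition (all three hypotheses discharged: `TheoremZ3UFinal.kr6'`, `HypUPlus.thmUPlus` via
`TheoremUEqFinal.thmUPlus'_iff`, `ThmFstarNFinal.thmFstar`): `PropDPrimeNFinal.lean`.
Hub records: `check/PropDPrimeN_standalone.lean` (the 23 bodies of the COROLLARY M cone + this module) and the split pair
`check/PropDPrimeN_link_standalone.lean` (`fullCheck_39` admitted) + `check/DecodingDPrime_part1_standalone.lean` (gen 32, proves it);
`GATE.md` § HF-G34.
-/

set_option autoImplicit false

namespace HodgeFermat.KRFree.PropDPrimeN

open HodgeFermat.KRFree.LemmaN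
open HodgeFermat.KRFree.TheoremUEq (ThmUPlus' Perm3)
open HodgeFermat.KRFree.TheoremZ3U (KR6')
open HodgeFermat.KRFree.CoincFull (classes39 InClass fullAt_39)

/-- **THEOREM F\*(3N)** as a hypothesis (verbatim `ThmFstarNFinal.thmFstar`, curried): `N ≥ 11`, `N ≠ 13` squarefree with all
prime factors `≥ 11`; two zero-sum triples mod `3N` with all entries prime to `N`, disjoint mod `3N`, do not have the same CM type. -/
def Fstar : Prop :=
  ∀ N a b c a' b' c' : ℕ, 11 ≤ N → N ≠ 13 → Squarefree N → (∀ p ∈ N.primeFactors, 11 ≤ p) →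
    3 * N ∣ a + b + c → 3 * N ∣ a' + b' + c' →
    Nat.Coprime a N → Nat.Coprime b N → Nat.Coprime c N →
    Nat.Coprime a' N → Nat.Coprime b' N → Nat.Coprime c' N →
    (∀ u v, (u = a ∨ u = b ∨ u = c) → (v = a' ∨ v = b' ∨ v = c') → ¬ u ≡ v [MOD 3 * N]) →
    SameType (3 * N) (a, b, c) (a', b', c') → False

/-! ## 1. Small facts about the level -/

/-- a number all of whose prime factors are `≥ 11` has no prime factor `< 11` -/
lemma not_dvd_of_primeFactors {N q : ℕ} (hN : 0 < N) (h11 : ∀ p ∈ N.primeFactors, 11 ≤ p)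
    (hq : q.Prime) (hq11 : q < 11) : ¬ q ∣ N := fun hd =>
  absurd (h11 q (Nat.mem_primeFactors.mpr ⟨hq, hd, hN.ne'⟩)) (by omega)

/-- `3N` is squarefree and odd -/
lemma level_facts {N : ℕ} (hN : 0 < N) (hsq : Squarefree N) (h11 : ∀ p ∈ N.primeFactors, 11 ≤ p) :
    Squarefree (3 * N) ∧ Odd (3 * N) := by
  have h2 := not_dvd_of_primeFactors hN h11 Nat.prime_two (by norm_num)
  have h3 := not_dvd_of_primeFactors hN h11 Nat.prime_three (by norm_num)
  have h3N : Nat.Coprime 3 N := (Nat.Prime.coprime_iff_not_dvd Nat.prime_three).mpr h3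
  refine ⟨(Nat.squarefree_mul h3N).mpr ⟨Nat.prime_three.squarefree, hsq⟩, ?_⟩
  exact Nat.odd_mul.mpr ⟨by decide, Nat.odd_iff.mpr (by omega)⟩

/-- an `N ≠ 1` all of whose prime factors are `≥ 11` is `≥ 11` -/
lemma eleven_le {N : ℕ} (hN : 0 < N) (h1 : N ≠ 1) (h11 : ∀ p ∈ N.primeFactors, 11 ≤ p) : 11 ≤ N := by
  obtain ⟨p, hp, hpN⟩ := Nat.exists_prime_and_dvd h1
  exact le_trans (h11 p (Nat.mem_primeFactors.mpr ⟨hp, hpN, hN.ne'⟩)) (Nat.le_of_dvd hN hpN)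

/-- an entry divisible by no prime of `N` is prime to `N` -/
lemma coprime_of_forall {N x : ℕ} (hN : 0 < N) (hx : ∀ q ∈ N.primeFactors, ¬ q ∣ x) : Nat.Coprime x N :=
  Nat.coprime_of_dvd fun k hk hkx hkN => hx k (Nat.mem_primeFactors.mpr ⟨hk, hkN, hN.ne'⟩) hkx

/-- COROLLARY M's clause 2 at level `3N`: every prime of `N` divides no entry, so all entries are prime to `N`. -/
lemma coprime_entries {N a b c a' b' c' : ℕ} (hN : 0 < N) (h11 : ∀ p ∈ N.primeFactors, 11 ≤ p)
    (h7 : ∀ q, Nat.Prime q → 7 ≤ q → q ∣ 3 * N →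
      ¬ q ∣ a ∧ ¬ q ∣ b ∧ ¬ q ∣ c ∧ ¬ q ∣ a' ∧ ¬ q ∣ b' ∧ ¬ q ∣ c') :
    Nat.Coprime a N ∧ Nat.Coprime b N ∧ Nat.Coprime c N ∧
      Nat.Coprime a' N ∧ Nat.Coprime b' N ∧ Nat.Coprime c' N := by
  have hq : ∀ q ∈ N.primeFactors, ¬ q ∣ a ∧ ¬ q ∣ b ∧ ¬ q ∣ c ∧ ¬ q ∣ a' ∧ ¬ q ∣ b' ∧ ¬ q ∣ c' :=
    fun q hq => h7 q (Nat.prime_of_mem_primeFactors hq) (le_trans (by norm_num) (h11 q hq))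
      (Dvd.dvd.mul_left (Nat.dvd_of_mem_primeFactors hq) 3)
  exact ⟨coprime_of_forall hN fun q h => (hq q h).1, coprime_of_forall hN fun q h => (hq q h).2.1,
    coprime_of_forall hN fun q h => (hq q h).2.2.1, coprime_of_forall hN fun q h => (hq q h).2.2.2.1,
    coprime_of_forall hN fun q h => (hq q h).2.2.2.2.1, coprime_of_forall hN fun q h => (hq q h).2.2.2.2.2⟩

/-! ## 2. PROPOSITION D′(3N) -/

/-- **PROPOSITION D′(3N)** (under `KR6'`, `ThmUPlus'`, and THEOREM F\*(3N) as `Fstar`).  `N` squarefree, all prime factors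
`≥ 11`, `N ≠ 13` (`N = 1`, the level `3`, included); `(a, b, c)`, `(a′, b′, c′)` zero-sum triples mod `3N` with no entry
`≡ 0 (mod 3N)`, JOINTLY PRIMITIVE (no prime of `3N` divides all six entries) and DISJOINT mod `3N`: they do not have the same
CM type at level `3N`. -/
theorem propDprime (hKR : KR6') (hUplus : ThmUPlus') (hF : Fstar) {N : ℕ} (hN : 0 < N) (hsq : Squarefree N)
    (h11 : ∀ p ∈ N.primeFactors, 11 ≤ p) (hN13 : N ≠ 13) {a b c a' b' c' : ℕ}
    (hs : 3 * N ∣ a + b + c) (ha : ¬ 3 * N ∣ a) (hb : ¬ 3 * N ∣ b) (hc : ¬ 3 * N ∣ c)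
    (hs' : 3 * N ∣ a' + b' + c') (ha' : ¬ 3 * N ∣ a') (hb' : ¬ 3 * N ∣ b') (hc' : ¬ 3 * N ∣ c')
    (hJ : ∀ q, Nat.Prime q → q ∣ 3 * N → q ∣ a → q ∣ b → q ∣ c → q ∣ a' → q ∣ b' → q ∣ c' → False)
    (hD : ∀ u v, (u = a ∨ u = b ∨ u = c) → (v = a' ∨ v = b' ∨ v = c') → ¬ u ≡ v [MOD 3 * N])
    (hH : SameType (3 * N) (a, b, c) (a', b', c')) : False := by
  obtain ⟨hsq3, hodd⟩ := level_facts hN hsq h11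
  obtain ⟨-, h7, -, h4, -⟩ := ThreeFinal.corollaryM_final hKR hUplus (3 * N) a b c a' b' c' hsq3 hodd
    hs ha hb hc hs' ha' hb' hc' hJ hD hH
  by_cases hN1 : N = 1
  · subst hN1
    rcases h4 (by norm_num) ⟨by simpa using ha, by simpa using hb, by simpa using hc, by simpa using ha',
      by simpa using hb', by simpa using hc'⟩ with h | h <;> omega
  · obtain ⟨ca, cb, cc, ca', cb', cc'⟩ := coprime_entries hN h11 h7
    exact hF N a b c a' b' c' (eleven_le hN hN1 h11) hN13 hsq h11 hs hs' ca cb cc ca' cb' cc' hD hH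

/-! ## 3. The descent -/

/-- the gcd of the level and the six entries, with its universal property -/
lemma exists_gcd (M a b c a' b' c' : ℕ) : ∃ g, g ∣ M ∧ g ∣ a ∧ g ∣ b ∧ g ∣ c ∧ g ∣ a' ∧ g ∣ b' ∧ g ∣ c' ∧
    ∀ d, d ∣ M → d ∣ a → d ∣ b → d ∣ c → d ∣ a' → d ∣ b' → d ∣ c' → d ∣ g := by
  refine ⟨Nat.gcd M (Nat.gcd a (Nat.gcd b (Nat.gcd c (Nat.gcd a' (Nat.gcd b' c'))))),
    Nat.gcd_dvd_left _ _, ?_, ?_, ?_, ?_, ?_, ?_, ?_⟩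
  · exact (Nat.gcd_dvd_right _ _).trans (Nat.gcd_dvd_left _ _)
  · exact (Nat.gcd_dvd_right _ _).trans ((Nat.gcd_dvd_right _ _).trans (Nat.gcd_dvd_left _ _))
  · exact (Nat.gcd_dvd_right _ _).trans ((Nat.gcd_dvd_right _ _).trans ((Nat.gcd_dvd_right _ _).trans
      (Nat.gcd_dvd_left _ _)))
  · exact (Nat.gcd_dvd_right _ _).trans ((Nat.gcd_dvd_right _ _).trans ((Nat.gcd_dvd_right _ _).trans
      ((Nat.gcd_dvd_right _ _).trans (Nat.gcd_dvd_left _ _))))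
  · exact (Nat.gcd_dvd_right _ _).trans ((Nat.gcd_dvd_right _ _).trans ((Nat.gcd_dvd_right _ _).trans
      ((Nat.gcd_dvd_right _ _).trans ((Nat.gcd_dvd_right _ _).trans (Nat.gcd_dvd_left _ _)))))
  · exact (Nat.gcd_dvd_right _ _).trans ((Nat.gcd_dvd_right _ _).trans ((Nat.gcd_dvd_right _ _).trans
      ((Nat.gcd_dvd_right _ _).trans ((Nat.gcd_dvd_right _ _).trans (Nat.gcd_dvd_right _ _)))))
  · intro d hM ha hb hc ha' hb' hc'
    exact Nat.dvd_gcd hM (Nat.dvd_gcd ha (Nat.dvd_gcd hb (Nat.dvd_gcd hc (Nat.dvd_gcd ha' (Nat.dvd_gcd hb' hc')))))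

/-- dividing the level and all entries by a common factor `G` preserves the data of a disjoint coincidence -/
lemma reduce {G ℓ a b c a' b' c' : ℕ} (hG : 0 < G) (hℓ : 0 < ℓ)
    (hs : G * ℓ ∣ G * a + G * b + G * c) (ha : ¬ G * ℓ ∣ G * a) (hb : ¬ G * ℓ ∣ G * b) (hc : ¬ G * ℓ ∣ G * c)
    (hs' : G * ℓ ∣ G * a' + G * b' + G * c') (ha' : ¬ G * ℓ ∣ G * a') (hb' : ¬ G * ℓ ∣ G * b')
    (hc' : ¬ G * ℓ ∣ G * c')
    (hD : ∀ u v, (u = G * a ∨ u = G * b ∨ u = G * c) → (v = G * a' ∨ v = G * b' ∨ v = G * c') →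
      ¬ u ≡ v [MOD G * ℓ])
    (hH : SameType (G * ℓ) (G * a, G * b, G * c) (G * a', G * b', G * c')) :
    ℓ ∣ a + b + c ∧ ¬ ℓ ∣ a ∧ ¬ ℓ ∣ b ∧ ¬ ℓ ∣ c ∧ ℓ ∣ a' + b' + c' ∧ ¬ ℓ ∣ a' ∧ ¬ ℓ ∣ b' ∧ ¬ ℓ ∣ c' ∧
      (∀ u v, (u = a ∨ u = b ∨ u = c) → (v = a' ∨ v = b' ∨ v = c') → ¬ u ≡ v [MOD ℓ]) ∧
      SameType ℓ (a, b, c) (a', b', c') := by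
  have down : ∀ {x : ℕ}, G * ℓ ∣ G * x → ℓ ∣ x := fun h => Nat.dvd_of_mul_dvd_mul_left hG h
  have up : ∀ {x : ℕ}, ℓ ∣ x → G * ℓ ∣ G * x := fun h => Nat.mul_dvd_mul_left G h
  refine ⟨down (by simpa only [mul_add] using hs), fun h => ha (up h), fun h => hb (up h), fun h => hc (up h),
    down (by simpa only [mul_add] using hs'), fun h => ha' (up h), fun h => hb' (up h), fun h => hc' (up h),
    ?_, Descent.sameType_descend hG hℓ hH⟩
  intro u v hu hv huv
  have hGuv : G * u ≡ G * v [MOD G * ℓ] := Nat.ModEq.mul_left' G huv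
  rcases hu with rfl | rfl | rfl <;> rcases hv with rfl | rfl | rfl
  · exact hD _ _ (Or.inl rfl) (Or.inl rfl) hGuv
  · exact hD _ _ (Or.inl rfl) (Or.inr (Or.inl rfl)) hGuv
  · exact hD _ _ (Or.inl rfl) (Or.inr (Or.inr rfl)) hGuv
  · exact hD _ _ (Or.inr (Or.inl rfl)) (Or.inl rfl) hGuv
  · exact hD _ _ (Or.inr (Or.inl rfl)) (Or.inr (Or.inl rfl)) hGuv
  · exact hD _ _ (Or.inr (Or.inl rfl)) (Or.inr (Or.inr rfl)) hGuv
  · exact hD _ _ (Or.inr (Or.inr rfl)) (Or.inl rfl) hGuv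
  · exact hD _ _ (Or.inr (Or.inr rfl)) (Or.inr (Or.inl rfl)) hGuv
  · exact hD _ _ (Or.inr (Or.inr rfl)) (Or.inr (Or.inr rfl)) hGuv

/-- a permutation of the residues contradicts disjointness -/
lemma perm3_modEq {M a b c a' b' c' : ℕ} (h : Perm3 (a % M) (b % M) (c % M) (a' % M) (b' % M) (c' % M)) :
    ∃ v, (v = a' ∨ v = b' ∨ v = c') ∧ a ≡ v [MOD M] := by
  rcases h with ⟨h1, -, -⟩ | ⟨h1, -, -⟩ | ⟨h1, -, -⟩ | ⟨h1, -, -⟩ | ⟨h1, -, -⟩ | ⟨h1, -, -⟩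
  exacts [⟨a', Or.inl rfl, h1⟩, ⟨a', Or.inl rfl, h1⟩, ⟨b', Or.inr (Or.inl rfl), h1⟩,
    ⟨b', Or.inr (Or.inl rfl), h1⟩, ⟨c', Or.inr (Or.inr rfl), h1⟩, ⟨c', Or.inr (Or.inr rfl), h1⟩]

/-! ### The two all-unit classes of level 39 -/

/-- the two classes of `CoincFull.classes39` made of all-unit triples: `(1, 16, 22) ∼ (2, 5, 32) ∼ (4, 10, 25) ∼ (8, 11, 20)` and
its negative; their `2·6 = 12` pairs are the twelve disjoint coincidences of level `39` of THEOREM D′ (`tables/DPRIME-THEOREM.md` §5) -/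
def units39 : List (List CoincFull.Tri) :=
  [[(1, 16, 22), (2, 5, 32), (4, 10, 25), (8, 11, 20)], [(7, 34, 37), (14, 29, 35), (17, 23, 38), (19, 28, 31)]]

/-- `units39 ⊆ classes39` -/
theorem units39_sub : ∀ cl ∈ units39, cl ∈ classes39 := by decide

/-- two triples share an entry -/
def Share (T T' : CoincFull.Tri) : Prop :=
  (T.1 = T'.1 ∨ T.1 = T'.2.1 ∨ T.1 = T'.2.2) ∨ (T.2.1 = T'.1 ∨ T.2.1 = T'.2.1 ∨ T.2.1 = T'.2.2) ∨
    (T.2.2 = T'.1 ∨ T.2.2 = T'.2.1 ∨ T.2.2 = T'.2.2)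

/-- `Share` is decidable -/
instance instDecidableShare (T T' : CoincFull.Tri) : Decidable (Share T T') := by
  unfold Share; infer_instance

/-- kernel check over the list: in every class of `classes39` other than the two of `units39`, any two members share an entry
(so a DISJOINT pair inside one class lies in `units39`) -/
theorem classes39_share : ∀ cl ∈ classes39, cl ∉ units39 → ∀ T ∈ cl, ∀ T' ∈ cl, Share T T' := by decide

/-- two triples that `Share` have a common entry -/
lemma share_common {T T' : CoincFull.Tri} (h : Share T T') :
    ∃ w, (w = T.1 ∨ w = T.2.1 ∨ w = T.2.2) ∧ (w = T'.1 ∨ w = T'.2.1 ∨ w = T'.2.2) := by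
  rcases h with (h | h | h) | (h | h | h) | (h | h | h)
  exacts [⟨_, Or.inl rfl, Or.inl h⟩, ⟨_, Or.inl rfl, Or.inr (Or.inl h)⟩, ⟨_, Or.inl rfl, Or.inr (Or.inr h)⟩,
    ⟨_, Or.inr (Or.inl rfl), Or.inl h⟩, ⟨_, Or.inr (Or.inl rfl), Or.inr (Or.inl h)⟩,
    ⟨_, Or.inr (Or.inl rfl), Or.inr (Or.inr h)⟩, ⟨_, Or.inr (Or.inr rfl), Or.inl h⟩,
    ⟨_, Or.inr (Or.inr rfl), Or.inr (Or.inl h)⟩, ⟨_, Or.inr (Or.inr rfl), Or.inr (Or.inr h)⟩]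

/-- an entry of the pattern triple is an entry of the permuted triple -/
lemma perm3_mem {A B C X Y Z : ℕ} (h : Perm3 A B C X Y Z) {w : ℕ} (hw : w = X ∨ w = Y ∨ w = Z) :
    w = A ∨ w = B ∨ w = C := by
  rcases h with ⟨rfl, rfl, rfl⟩ | ⟨rfl, rfl, rfl⟩ | ⟨rfl, rfl, rfl⟩ | ⟨rfl, rfl, rfl⟩ | ⟨rfl, rfl, rfl⟩ |
    ⟨rfl, rfl, rfl⟩ <;> omega

/-- **THE DESCENT — THEOREM F\* in full** (under `KR6'`, `ThmUPlus'`, `Fstar`).  `N > 0` squarefree with all prime factors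
`≥ 11`; `(a, b, c)`, `(a′, b′, c′)` zero-sum triples mod `3N`, no entry `≡ 0 (mod 3N)`, DISJOINT mod `3N`, of the same CM type
at level `3N` — no primitivity, no coprimality assumed.  Then `N = 13·g` where `g` divides all six entries, and the reduced
triples `(a/g, b/g, c/g)`, `(a′/g, b′/g, c′/g)` reduce mod `39` into ONE of the two all-unit classes `units39` of the complete level-39
list `CoincFull.classes39` — i.e. the pair is `g` times one of the twelve disjoint all-unit coincidences of level `39` (THEOREM D′). -/
theorem descent (hKR : KR6') (hUplus : ThmUPlus') (hF : Fstar) {N : ℕ} (hN : 0 < N) (hsq : Squarefree N)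
    (h11 : ∀ p ∈ N.primeFactors, 11 ≤ p) {a b c a' b' c' : ℕ}
    (hs : 3 * N ∣ a + b + c) (ha : ¬ 3 * N ∣ a) (hb : ¬ 3 * N ∣ b) (hc : ¬ 3 * N ∣ c)
    (hs' : 3 * N ∣ a' + b' + c') (ha' : ¬ 3 * N ∣ a') (hb' : ¬ 3 * N ∣ b') (hc' : ¬ 3 * N ∣ c')
    (hD : ∀ u v, (u = a ∨ u = b ∨ u = c) → (v = a' ∨ v = b' ∨ v = c') → ¬ u ≡ v [MOD 3 * N])
    (hH : SameType (3 * N) (a, b, c) (a', b', c')) :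
    ∃ g, N = 13 * g ∧ g ∣ a ∧ g ∣ b ∧ g ∣ c ∧ g ∣ a' ∧ g ∣ b' ∧ g ∣ c' ∧
      ∃ cl ∈ units39, InClass cl (a / g % 39) (b / g % 39) (c / g % 39) ∧
        InClass cl (a' / g % 39) (b' / g % 39) (c' / g % 39) := by
  obtain ⟨hsq3, hodd3⟩ := level_facts hN hsq h11
  obtain ⟨g, hgM, ⟨a₁, rfl⟩, ⟨b₁, rfl⟩, ⟨c₁, rfl⟩, ⟨a₂, rfl⟩, ⟨b₂, rfl⟩, ⟨c₂, rfl⟩, hmax⟩ :=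
    exists_gcd (3 * N) a b c a' b' c'
  obtain ⟨ℓ, hℓ⟩ := hgM
  have hg : 0 < g := Nat.pos_of_ne_zero (by rintro rfl; omega)
  have hℓpos : 0 < ℓ := Nat.pos_of_ne_zero (by rintro rfl; omega)
  have hℓdvd : ℓ ∣ 3 * N := ⟨g, by rw [hℓ, mul_comm]⟩
  rw [hℓ] at hs ha hb hc hs' ha' hb' hc' hD hH
  obtain ⟨hs₁, ha₁, hb₁, hc₁, hs₂, ha₂, hb₂, hc₂, hD₁, hH₁⟩ := reduce hg hℓpos hs ha hb hc hs' ha' hb' hc' hD hH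
  -- the reduced pair is jointly primitive at level ℓ (maximality of g)
  have hJ₁ : ∀ q, Nat.Prime q → q ∣ ℓ → q ∣ a₁ → q ∣ b₁ → q ∣ c₁ → q ∣ a₂ → q ∣ b₂ → q ∣ c₂ → False := by
    intro q hq hqℓ qa qb qc qa' qb' qc'
    have hdvd : g * q ∣ g := hmax (g * q) (by rw [hℓ]; exact Nat.mul_dvd_mul_left g hqℓ)
      (Nat.mul_dvd_mul_left g qa) (Nat.mul_dvd_mul_left g qb) (Nat.mul_dvd_mul_left g qc)
      (Nat.mul_dvd_mul_left g qa') (Nat.mul_dvd_mul_left g qb') (Nat.mul_dvd_mul_left g qc')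
    have h1 := Nat.le_of_dvd hg hdvd
    have h2 := Nat.mul_le_mul_left g hq.two_le
    omega
  -- COROLLARY M at the squarefree odd level ℓ: 3 ∣ ℓ
  have hsqℓ : Squarefree ℓ := hsq3.squarefree_of_dvd hℓdvd
  have hoddℓ : Odd ℓ := hodd3.of_dvd_nat hℓdvd
  obtain ⟨⟨ℓ₁, rfl⟩, h7, -, h4, -⟩ := ThreeFinal.corollaryM_final hKR hUplus ℓ a₁ b₁ c₁ a₂ b₂ c₂ hsqℓ hoddℓ
    hs₁ ha₁ hb₁ hc₁ hs₂ ha₂ hb₂ hc₂ hJ₁ hD₁ hH₁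
  have hℓ₁N : ℓ₁ ∣ N := Nat.dvd_of_mul_dvd_mul_left (by norm_num : 0 < 3) hℓdvd
  have hℓ₁ : 0 < ℓ₁ := Nat.pos_of_dvd_of_pos hℓ₁N hN
  have h11ℓ : ∀ p ∈ ℓ₁.primeFactors, 11 ≤ p := fun p hp =>
    h11 p (Nat.mem_primeFactors.mpr ⟨Nat.prime_of_mem_primeFactors hp,
      (Nat.dvd_of_mem_primeFactors hp).trans hℓ₁N, hN.ne'⟩)
  by_cases h1 : ℓ₁ = 1
  · -- level 3: clause 4 of COROLLARY M
    exfalso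
    subst h1
    rcases h4 (by norm_num) ⟨by simpa using ha₁, by simpa using hb₁, by simpa using hc₁, by simpa using ha₂,
      by simpa using hb₂, by simpa using hc₂⟩ with h | h <;> omega
  by_cases h13 : ℓ₁ = 13
  · -- level 39: the complete list
    subst h13
    refine ⟨g, by omega, Dvd.intro _ rfl, Dvd.intro _ rfl, Dvd.intro _ rfl, Dvd.intro _ rfl, Dvd.intro _ rfl,
      Dvd.intro _ rfl, ?_⟩
    simp only [Nat.mul_div_cancel_left _ hg]
    have e39 : (3 : ℕ) * 13 = 39 := rfl
    rw [e39] at hs₁ ha₁ hb₁ hc₁ hs₂ ha₂ hb₂ hc₂ hD₁ hH₁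
    rcases fullAt_39 a₁ b₁ c₁ a₂ b₂ c₂ ha₁ hb₁ hc₁ ha₂ hb₂ hc₂ hs₁ hs₂ hH₁ with hP | ⟨cl, hcl, hT, hT'⟩
    · obtain ⟨v, hv, hav⟩ := perm3_modEq hP
      exact absurd hav (hD₁ a₁ v (Or.inl rfl) hv)
    · refine ⟨cl, ?_, hT, hT'⟩
      -- a disjoint pair inside one class: the class is one of the two all-unit classes
      by_contra hu
      obtain ⟨T, hTcl, hpT⟩ := hT
      obtain ⟨T', hT'cl, hpT'⟩ := hT'
      obtain ⟨w, hw, hw'⟩ := share_common (classes39_share cl hcl hu T hTcl T' hT'cl)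
      rcases perm3_mem hpT hw with rfl | rfl | rfl <;> rcases perm3_mem hpT' hw' with h | h | h
      all_goals exact hD₁ _ _ (by simp) (by simp) h
  · -- every other level 3ℓ₁: THEOREM F*(3ℓ₁)
    exfalso
    obtain ⟨ca, cb, cc, ca', cb', cc'⟩ := coprime_entries hℓ₁ h11ℓ h7
    exact hF ℓ₁ a₁ b₁ c₁ a₂ b₂ c₂ (eleven_le hℓ₁ h1 h11ℓ) h13 (hsq.squarefree_of_dvd hℓ₁N) h11ℓ hs₁ hs₂
      ca cb cc ca' cb' cc' hD₁ hH₁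

/-- **COROLLARY (no disjoint coincidence off the multiples of 13).**  Same hypotheses with `13 ∤ N`: two disjoint zero-sum
triples mod `3N` with no entry `≡ 0 (mod 3N)` never have the same CM type — whatever their common factors. -/
theorem noCoincidence (hKR : KR6') (hUplus : ThmUPlus') (hF : Fstar) {N : ℕ} (hN : 0 < N) (hsq : Squarefree N)
    (h11 : ∀ p ∈ N.primeFactors, 11 ≤ p) (h13 : ¬ 13 ∣ N) {a b c a' b' c' : ℕ}
    (hs : 3 * N ∣ a + b + c) (ha : ¬ 3 * N ∣ a) (hb : ¬ 3 * N ∣ b) (hc : ¬ 3 * N ∣ c)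
    (hs' : 3 * N ∣ a' + b' + c') (ha' : ¬ 3 * N ∣ a') (hb' : ¬ 3 * N ∣ b') (hc' : ¬ 3 * N ∣ c')
    (hD : ∀ u v, (u = a ∨ u = b ∨ u = c) → (v = a' ∨ v = b' ∨ v = c') → ¬ u ≡ v [MOD 3 * N])
    (hH : SameType (3 * N) (a, b, c) (a', b', c')) : False := by
  obtain ⟨g, hg, -⟩ := descent hKR hUplus hF hN hsq h11 hs ha hb hc hs' ha' hb' hc' hD hH
  exact h13 ⟨g, hg⟩


end HodgeFermat.KRFree.PropDPrimeN
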